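import Literature.NumberTheory.EllipticCurves.HeightDensityFullBSDOffSm
import Literature.NumberTheory.EllipticCurves.LeadingTermBSZResCellAssemblyProofs
import HarnessLib

/-!
# Rows (ii-1) and (ii-2) of `PERCENT-FULL.md` at `c_rank = 0.66856…` with the rank-part input discharged to the pieces

`HeightDensityFullBSDOffSSieve.lean` (row (ii-1)) and `HeightDensityFullBSDOffSm.lean` (row (ii-2)) of
the `pub-bsdpct` cell type, as TRANSFER theorems, the statements 'for at least a proportion `c` of
the curves `E_{A,B}/ℚ` ordered by naive height, the rank part of BSD with analytic rank `≤ 1` AND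
Miller's `BSD(E,p)` at every prime `p ≥ 5` of good ordinary reduction outside the finite set `Z*(E)`
(`FullBSDOffSgoPrime`)', resp. '… and at every multiplicative `p ≥ 5` outside `M*(E) ∪ Z*(E)`
(`FullBSDOffSmPrime`)', conditional on Duke 1997 Thm. 1, Skinner–Urban 2014 Thm. 2 (a) (bsd.S30),
W. Zhang 2014 Thm. 1.6/1.4, modularity, Gross–Zagier–Kolyvagin (row (ii-2): also Skinner 2016 Thm. C
and the OPEN Skinner–Zhang 2014 Thm. 1.2) and on the rank-part INPUT
`hA : HeightDensityGE SatisfiesBSDRankLeOne c`; at the cell's audited constant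
`c_rank = 3059480216411717/4576171406400000 = 0.66856766…` (Theorem A′ of the cell's bundle) `hA`
is there a BARE hypothesis (`heightDensityGE_rankLeOne_and_fullBSDOffSgoPrime_cRank_of_sieve`,
`heightDensityGE_rankLeOne_and_fullBSDOffSmPrime_cRank_of_sieve`), the bundle's Lean package not
being part of this tree. `HeightDensityFullBSDOffSPieces.lean` discharged `hA` to the pieces of
Bhargava–Skinner–Zhang's Cor. 26 at the corrected constant `0.6597` of the PRINTED argument.

`LeadingTermBSZResCellAssemblyProofs.lean` PROVES the rank-part input AT `c_rank` from pieces
(`bsz_rankLeOne_cRank_of_pieces`): Cor. 26 of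

> M. Bhargava, C. Skinner, W. Zhang, arXiv:1407.1826v2 (2014), Cor. 26 (proof),

assembled with a fourth piece `P` (the slice `SP′` of multiplicative reduction at `5` outside
`S₁'(5)` and outside the Tate-fifth-power set, truncated at `ord₅ Δ ≤ K`) run in the local-condition
mode of

> M. Bhargava, C. Skinner, J. Ramanujan Math. Soc. 29 (2014), Thm 7 (ii) and Lemma 16
> (equidistribution of the non-identity `5`-Selmer elements in `E(ℚ₅)/5E(ℚ₅)`),

combined with the rank-`1` converse under the local condition (`res`) of

> C.-H. Kim, Math. Ann. 387 (2023) 1961–1968, Thm 1.1 (with Thm 2.3 = Bertolini–Darmon–Venerucci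
> 2022 Thm A for (`PRC`), and (`IMC[1/p]`) at the multiplicative prime from Skinner 2016 Thm A),

every deep input an explicit hypothesis in the shape the counting consumes (Thm 5 `h5`, Thm 9 `h9`,
Thm 13 `h13T`/`h13U₀`, Thm 15 `hDD`, Thm 16 `κ = .5501`, Lemmas 17–19 the exact densities
`μ(S₁'(5)) = 747265625/953369043`, `μ(T₅) = 78125/3813476172`, `μ(SP′) - 10⁻⁶ =
20546875/1271158724 - 10⁻⁶`, `ν = 10⁻⁵`, Lemma 20 `W`; the kernel bound `hker`, the local
equidistribution count `hlocP` and Kim's converse `hKim` on `P`).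

This file composes the two, exactly as `HeightDensityFullBSDOffSPieces.lean` does at `0.6597`: rows
(ii-1) and (ii-2), parametrised (`δ ≤ (19/24 + κ/12)·μT + 3/8·κ·μR + 3/4·μP - ν`) and AT THE CELL'S
CONSTANT `c_rank`, with `hA` REPLACED by the primary inputs. Nothing is cited beyond the sources of the
files composed; no definition and no named fact is introduced (D-0026 debt `0`); no constant of the
cell changes — what this file adds is that the floor of rows (ii-1)/(ii-2) whose every input is a
published theorem taken as an explicit binder (row (ii-2): plus the OPEN Skinner–Zhang binder),
kernel-composed, is now the cell's printed `c_rank` itself (previously `0.6597`).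

## References

* M. Bhargava, C. Skinner, W. Zhang, arXiv:1407.1826v2 (2014), Thms 5, 9, 13, 15, 16, 21, 25,
  Lemmas 17–20, Cor. 26 (pp. 7–13). [cite: BhargavaSkinnerZhang2014, Cor. 26 (proof)]
* M. Bhargava, C. Skinner, J. Ramanujan Math. Soc. 29 (2014) 221–242, Thm 7 (ii), Lemma 16.
  [cite: BhargavaSkinner2014, Thm 7 (ii) and Lemma 16]
* C.-H. Kim, Math. Ann. 387 (2023) 1961–1968, Thm 1.1, Thm 2.3. [cite: Kim2022, Thm 1.1]
* W. Duke, C. R. Acad. Sci. Paris 325 (1997) 813–818, Thm. 1. [cite: Duke1997, Thm. 1 (p. 815)]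
* C. Skinner, E. Urban, Invent. Math. 195 (2014) 1–277, Thm. 2 (a). [cite: SkinnerUrban2014, Thm. 2 (a)]
* W. Zhang, Camb. J. Math. 2 (2014) 191–253, Thm. 1.4, 1.6. [cite: WZhang2014, Thm. 1.6 (p. 199)]
* C. Skinner, Pacific J. Math. 283 (2016) 171–200, Thm. A, Thm. C (p. 173).
  [cite: Skinner2016PacificMC, Thm. C]
* C. Skinner, W. Zhang, arXiv:1407.1099 (2014), Thm. 1.2. [claim: SkinnerZhang2014, status: under-review]
* R. L. Miller, LMS J. Comput. Math. 14 (2011), Def. 1.1 (`BSDp`). [cite: Miller2011LMS, Def. 1.1]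
-/

noncomputable section

open scoped Classical
open scoped AddSubgroup
open WeierstrassCurve Filter Topology Literature.NumberTheory.EllipticCurves

namespace Literature.NumberTheory.EllipticCurves

/-- **Row (ii-1), from the pieces with a local-condition piece (parametrised).** In the notation of
`heightDensityGE_satisfiesBSDRankLeOne_of_resPieces` (families `S₀ ⊇ T ⊇ U`, `S₀ ⊇ R ⊇ U₀`,
`S₀ ⊇ P`, with `T`, `R`, `P` pairwise disjoint; `S₁`, `W`; twist-stability and reversed root numbers
on `U`, `U₀`; Thm 5 as `h5`, Thm 9 as `h9`, Thm 13 as `h13T`/`h13U₀`, Thm 15 as `hDD`; on `P` the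
kernel subgroups `Z(E) ≤ Sel₅(E)` of index `≤ 5` (`hker`), the local equidistribution count (`hlocP`,
Bhargava–Skinner Thm 7 (ii)/Lemma 16) and Kim's rank-`1` converse under the local condition (`hKim`);
densities `μT`, `κ`, `μR`, `μP`, `ν` and the density-one set `W`) and given Duke 1997 Thm. 1,
Skinner–Urban 2014 Thm. 2 (a), W. Zhang 2014 Thm. 1.6, modularity and Gross–Zagier–Kolyvagin: for
every `δ ≤ (19/24 + κ/12)·μT + 3/8·κ·μR + 3/4·μP - ν`, at least a proportion `δ` of the curves
`E_{A,B}/ℚ`, ordered by naive height, satisfy the rank part of BSD with analytic rank `≤ 1` AND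
`BSD(E,p)` at every prime `p ≥ 5` of good ordinary reduction outside `Z*(E)` (`FullBSDOffSgoPrime`).
`= HeightDensityGE.rankLeOne_and_fullBSDOffSgoPrime_of_sieve` with its binder `hA` supplied by
`heightDensityGE_satisfiesBSDRankLeOne_of_resPieces`.
[cite: BhargavaSkinnerZhang2014, Cor. 26 (proof)] [cite: BhargavaSkinner2014, Thm 7 (ii) and Lemma 16]
[cite: Kim2022, Thm 1.1] [cite: SkinnerUrban2014, Thm. 2 (a)] [cite: WZhang2014, Thm. 1.6 (p. 199)]
[cite: Duke1997, Thm. 1 (p. 815)] -/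
theorem HeightDensityGE.rankLeOne_and_fullBSDOffSgoPrime_of_resPieces
    (hGZK : rank_eq_analyticRank_of_analyticRank_le_one)
    (hDD : even_selmerRank_sub_torsionRank_iff) (S₀ T U R U₀ P S₁ W : ℤ × ℤ → Prop)
    (Z : (AB : ℤ × ℤ) → AddSubgroup ((shortWeierstrass AB).selmerGroup 5))
    (hTS₀ : ∀ AB, T AB → S₀ AB) (hUT : ∀ AB, U AB → T AB)
    (hRS₀ : ∀ AB, R AB → S₀ AB) (hRT : ∀ AB, R AB → ¬ T AB) (hU₀R : ∀ AB, U₀ AB → R AB)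
    (hPS₀ : ∀ AB, P AB → S₀ AB) (hPT : ∀ AB, P AB → ¬ T AB) (hPR : ∀ AB, P AB → ¬ R AB)
    (hU : ∀ AB, U AB → U (negB AB))
    (hUflip : ∀ AB, U AB →
      (shortWeierstrass (negB AB)).rootNumber = -(shortWeierstrass AB).rootNumber)
    (hU₀ : ∀ AB, U₀ AB → U₀ (negB AB))
    (hU₀flip : ∀ AB, U₀ AB →
      (shortWeierstrass (negB AB)).rootNumber = -(shortWeierstrass AB).rootNumber)
    (h5 : ∀ AB, IsInHeightFamily AB → S₀ AB → W AB →
      Nat.card ((shortWeierstrass AB).selmerGroup 5) = 1 →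
        (shortWeierstrass AB).mordellWeilRank = 0 ∧ (shortWeierstrass AB).analyticRank = 0)
    (h9 : ∀ AB, IsInHeightFamily AB → T AB → S₁ AB → W AB →
      Nat.card ((shortWeierstrass AB).selmerGroup 5) = 5 →
        (shortWeierstrass AB).mordellWeilRank = 1 ∧ (shortWeierstrass AB).analyticRank = 1)
    (hker : ∀ AB, IsInHeightFamily AB → P AB →
      Nat.card ((shortWeierstrass AB).selmerGroup 5) ≤ 5 * Nat.card (Z AB))
    (hKim : ∀ AB, IsInHeightFamily AB → P AB → W AB →
      Nat.card ((shortWeierstrass AB).selmerGroup 5) = 5 → Nat.card (Z AB) = 1 →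
        (shortWeierstrass AB).mordellWeilRank = 1 ∧ (shortWeierstrass AB).analyticRank = 1)
    (hWtors : ∀ AB, IsInHeightFamily AB → W AB → (shortWeierstrass AB).toAffine.Point[(5 : ℤ)] = ⊥)
    (h13T : ∀ η : ℝ, 0 < η → ∀ᶠ X : ℕ in atTop,
      ∑ AB ∈ (heightFamilyBelow X).filter T,
          (Nat.card ((shortWeierstrass AB).selmerGroup 5) : ℝ) ≤
        (6 + η) * ((heightFamilyBelow X).filter T).card)
    (h13U₀ : ∀ η : ℝ, 0 < η → ∀ᶠ X : ℕ in atTop,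
      ∑ AB ∈ (heightFamilyBelow X).filter U₀,
          (Nat.card ((shortWeierstrass AB).selmerGroup 5) : ℝ) ≤
        (6 + η) * ((heightFamilyBelow X).filter U₀).card)
    (hlocP : ∀ η : ℝ, 0 < η → ∀ᶠ X : ℕ in atTop,
      ∑ AB ∈ (heightFamilyBelow X).filter P, ((Nat.card (Z AB) : ℝ) - 1) ≤
        (1 + η) * ((heightFamilyBelow X).filter P).card)
    {μT κ μR μP ν : ℝ} (hκ : 0 < κ) (hκ1 : κ ≤ 1) (hμT1 : μT ≤ 1) (hμR1 : μR ≤ 1) (hμP1 : μP ≤ 1)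
    (hT : ∀ η : ℝ, 0 < η → ∀ᶠ X : ℕ in atTop,
      (μT - η) * (heightFamilyBelow X).card ≤ ((heightFamilyBelow X).filter T).card)
    (hκU : ∀ η : ℝ, 0 < η → ∀ᶠ X : ℕ in atTop,
      (κ - η) * ((heightFamilyBelow X).filter T).card ≤ ((heightFamilyBelow X).filter U).card)
    (hR : ∀ η : ℝ, 0 < η → ∀ᶠ X : ℕ in atTop,
      (μR - η) * (heightFamilyBelow X).card ≤ ((heightFamilyBelow X).filter R).card)
    (hκU₀ : ∀ η : ℝ, 0 < η → ∀ᶠ X : ℕ in atTop,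
      (κ - η) * ((heightFamilyBelow X).filter R).card ≤ ((heightFamilyBelow X).filter U₀).card)
    (hPd : ∀ η : ℝ, 0 < η → ∀ᶠ X : ℕ in atTop,
      (μP - η) * (heightFamilyBelow X).card ≤ ((heightFamilyBelow X).filter P).card)
    (hν : ∀ η : ℝ, 0 < η → ∀ᶠ X : ℕ in atTop,
      (((heightFamilyBelow X).filter (fun AB ↦ T AB ∧ ¬ S₁ AB)).card : ℝ) ≤
        (ν + η) * (heightFamilyBelow X).card)
    (hW : ∀ η : ℝ, 0 < η → ∀ᶠ X : ℕ in atTop,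
      (((heightFamilyBelow X).filter (fun AB ↦ ¬ W AB)).card : ℝ) ≤ η * (heightFamilyBelow X).card)
    (hD : Duke1997_exceptionalPrimes_densityZero)
    (hS30 : padicValRat_bsd_rank_zero) (hZh : WZhang2014_padicValRat_bsd_rank_one_ordinary)
    (hmod : hasEntireLFunction_rat)
    {δ : ℝ} (hδ : δ ≤ (19 / 24 + κ / 12) * μT + 3 / 8 * κ * μR + 3 / 4 * μP - ν) :
    HeightDensityGE (fun AB ↦ SatisfiesBSDRankLeOne AB ∧ FullBSDOffSgoPrime AB) δ :=
  HeightDensityGE.rankLeOne_and_fullBSDOffSgoPrime_of_sieve hD hS30 hZh hmod hGZK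
    (heightDensityGE_satisfiesBSDRankLeOne_of_resPieces hGZK hDD S₀ T U R U₀ P S₁ W Z hTS₀ hUT hRS₀
      hRT hU₀R hPS₀ hPT hPR hU hUflip hU₀ hU₀flip h5 h9 hker hKim hWtors h13T h13U₀ hlocP hκ hκ1 hμT1
      hμR1 hμP1 hT hκU hR hκU₀ hPd hν hW hδ)

/-- **Row (ii-1) of `PERCENT-FULL.md` AT THE CELL'S CONSTANT `c_rank = 3059480216411717 /
4576171406400000 = 0.66856766…`, from the pieces** — the statement of
`heightDensityGE_rankLeOne_and_fullBSDOffSgoPrime_cRank_of_sieve` with its bare hypothesis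
`hA : HeightDensityGE SatisfiesBSDRankLeOne c_rank` REPLACED by the primary inputs
(`bsz_rankLeOne_cRank_of_pieces`: `κ = .5501` (Thm 16), `μT = μ(S₁'(5)) = 747265625/953369043`
(Lemma 18 corrected), `μR = μ(T₅) = 78125/3813476172`, `μP = μ(SP′) - 10⁻⁶`, `ν = 10⁻⁵` (Lemma 19)):
GIVEN Thm 5 on `S₀ ∩ W` (`h5`), Thm 9 on `T ∩ S₁ ∩ W` (`h9`), the kernel bound, the local
equidistribution count and Kim's converse on `P` (`hker`, `hlocP`, `hKim`), Thm 13 on `T` and on `U₀`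
(`h13T`, `h13U₀`), Thm 15 (`hDD`), the densities (`hT`, `hκU`, `hR`, `hκU₀`, `hPd`, `hν`, `hW`), Duke
1997 Thm. 1, Skinner–Urban 2014 Thm. 2 (a), W. Zhang 2014 Thm. 1.6, modularity and
Gross–Zagier–Kolyvagin, at least a proportion `c_rank` (`66.85%`) of the curves `E_{A,B}/ℚ`, ordered
by naive height, satisfy the rank part of BSD with analytic rank `≤ 1` and `BSD(E,p)` at every prime
`p ≥ 5` of good ordinary reduction outside `Z*(E)`.
[cite: BhargavaSkinnerZhang2014, Cor. 26 (proof) with Lemma 18 corrected]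
[cite: BhargavaSkinner2014, Thm 7 (ii) and Lemma 16] [cite: Kim2022, Thm 1.1]
[cite: SkinnerUrban2014, Thm. 2 (a)] [cite: WZhang2014, Thm. 1.6 (p. 199)]
[cite: Duke1997, Thm. 1 (p. 815)] -/
theorem heightDensityGE_rankLeOne_and_fullBSDOffSgoPrime_cRank_of_pieces
    (hGZK : rank_eq_analyticRank_of_analyticRank_le_one)
    (hDD : even_selmerRank_sub_torsionRank_iff) (S₀ T U R U₀ P S₁ W : ℤ × ℤ → Prop)
    (Z : (AB : ℤ × ℤ) → AddSubgroup ((shortWeierstrass AB).selmerGroup 5))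
    (hTS₀ : ∀ AB, T AB → S₀ AB) (hUT : ∀ AB, U AB → T AB)
    (hRS₀ : ∀ AB, R AB → S₀ AB) (hRT : ∀ AB, R AB → ¬ T AB) (hU₀R : ∀ AB, U₀ AB → R AB)
    (hPS₀ : ∀ AB, P AB → S₀ AB) (hPT : ∀ AB, P AB → ¬ T AB) (hPR : ∀ AB, P AB → ¬ R AB)
    (hU : ∀ AB, U AB → U (negB AB))
    (hUflip : ∀ AB, U AB →
      (shortWeierstrass (negB AB)).rootNumber = -(shortWeierstrass AB).rootNumber)
    (hU₀ : ∀ AB, U₀ AB → U₀ (negB AB))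
    (hU₀flip : ∀ AB, U₀ AB →
      (shortWeierstrass (negB AB)).rootNumber = -(shortWeierstrass AB).rootNumber)
    (h5 : ∀ AB, IsInHeightFamily AB → S₀ AB → W AB →
      Nat.card ((shortWeierstrass AB).selmerGroup 5) = 1 →
        (shortWeierstrass AB).mordellWeilRank = 0 ∧ (shortWeierstrass AB).analyticRank = 0)
    (h9 : ∀ AB, IsInHeightFamily AB → T AB → S₁ AB → W AB →
      Nat.card ((shortWeierstrass AB).selmerGroup 5) = 5 →
        (shortWeierstrass AB).mordellWeilRank = 1 ∧ (shortWeierstrass AB).analyticRank = 1)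
    (hker : ∀ AB, IsInHeightFamily AB → P AB →
      Nat.card ((shortWeierstrass AB).selmerGroup 5) ≤ 5 * Nat.card (Z AB))
    (hKim : ∀ AB, IsInHeightFamily AB → P AB → W AB →
      Nat.card ((shortWeierstrass AB).selmerGroup 5) = 5 → Nat.card (Z AB) = 1 →
        (shortWeierstrass AB).mordellWeilRank = 1 ∧ (shortWeierstrass AB).analyticRank = 1)
    (hWtors : ∀ AB, IsInHeightFamily AB → W AB → (shortWeierstrass AB).toAffine.Point[(5 : ℤ)] = ⊥)
    (h13T : ∀ η : ℝ, 0 < η → ∀ᶠ X : ℕ in atTop,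
      ∑ AB ∈ (heightFamilyBelow X).filter T,
          (Nat.card ((shortWeierstrass AB).selmerGroup 5) : ℝ) ≤
        (6 + η) * ((heightFamilyBelow X).filter T).card)
    (h13U₀ : ∀ η : ℝ, 0 < η → ∀ᶠ X : ℕ in atTop,
      ∑ AB ∈ (heightFamilyBelow X).filter U₀,
          (Nat.card ((shortWeierstrass AB).selmerGroup 5) : ℝ) ≤
        (6 + η) * ((heightFamilyBelow X).filter U₀).card)
    (hlocP : ∀ η : ℝ, 0 < η → ∀ᶠ X : ℕ in atTop,
      ∑ AB ∈ (heightFamilyBelow X).filter P, ((Nat.card (Z AB) : ℝ) - 1) ≤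
        (1 + η) * ((heightFamilyBelow X).filter P).card)
    (hT : ∀ η : ℝ, 0 < η → ∀ᶠ X : ℕ in atTop,
      (747265625 / 953369043 - η) * (heightFamilyBelow X).card ≤
        ((heightFamilyBelow X).filter T).card)
    (hκU : ∀ η : ℝ, 0 < η → ∀ᶠ X : ℕ in atTop,
      (0.5501 - η) * ((heightFamilyBelow X).filter T).card ≤ ((heightFamilyBelow X).filter U).card)
    (hR : ∀ η : ℝ, 0 < η → ∀ᶠ X : ℕ in atTop,
      (78125 / 3813476172 - η) * (heightFamilyBelow X).card ≤ ((heightFamilyBelow X).filter R).card)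
    (hκU₀ : ∀ η : ℝ, 0 < η → ∀ᶠ X : ℕ in atTop,
      (0.5501 - η) * ((heightFamilyBelow X).filter R).card ≤ ((heightFamilyBelow X).filter U₀).card)
    (hPd : ∀ η : ℝ, 0 < η → ∀ᶠ X : ℕ in atTop,
      (20546875 / 1271158724 - 1 / 1000000 - η) * (heightFamilyBelow X).card ≤
        ((heightFamilyBelow X).filter P).card)
    (hν : ∀ η : ℝ, 0 < η → ∀ᶠ X : ℕ in atTop,
      (((heightFamilyBelow X).filter (fun AB ↦ T AB ∧ ¬ S₁ AB)).card : ℝ) ≤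
        (0.00001 + η) * (heightFamilyBelow X).card)
    (hW : ∀ η : ℝ, 0 < η → ∀ᶠ X : ℕ in atTop,
      (((heightFamilyBelow X).filter (fun AB ↦ ¬ W AB)).card : ℝ) ≤ η * (heightFamilyBelow X).card)
    (hD : Duke1997_exceptionalPrimes_densityZero)
    (hS30 : padicValRat_bsd_rank_zero) (hZh : WZhang2014_padicValRat_bsd_rank_one_ordinary)
    (hmod : hasEntireLFunction_rat) :
    HeightDensityGE (fun AB ↦ SatisfiesBSDRankLeOne AB ∧ FullBSDOffSgoPrime AB)
      (3059480216411717 / 4576171406400000) :=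
  heightDensityGE_rankLeOne_and_fullBSDOffSgoPrime_cRank_of_sieve
    (bsz_rankLeOne_cRank_of_pieces hGZK hDD S₀ T U R U₀ P S₁ W Z hTS₀ hUT hRS₀ hRT hU₀R hPS₀ hPT hPR
      hU hUflip hU₀ hU₀flip h5 h9 hker hKim hWtors h13T h13U₀ hlocP hT hκU hR hκU₀ hPd hν hW)
    hD hS30 hZh hmod hGZK

/-- **Row (ii-2), from the pieces with a local-condition piece (parametrised).** As
`HeightDensityGE.rankLeOne_and_fullBSDOffSgoPrime_of_resPieces`, and given in addition Skinner 2016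
Thm. C (`hSk`) and the OPEN Skinner–Zhang 2014 Thm. 1.2 (`hSZ`, unrefereed; used only at
multiplicative primes in rank `1`): for every `δ ≤ (19/24 + κ/12)·μT + 3/8·κ·μR + 3/4·μP - ν`, at
least a proportion `δ` of the curves `E_{A,B}/ℚ`, ordered by naive height, satisfy the rank part of
BSD with analytic rank `≤ 1` AND `BSD(E,p)` at every prime `p ≥ 5` that is good ordinary outside
`Z*(E)` (`FullBSDOffSgoPrime`) or multiplicative outside `M*(E) ∪ Z*(E)` (`FullBSDOffSmPrime`).
`= HeightDensityGE.rankLeOne_and_fullBSDOffSmPrime_of_sieve` with its binder `hA` supplied by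
`heightDensityGE_satisfiesBSDRankLeOne_of_resPieces`.
[cite: BhargavaSkinnerZhang2014, Cor. 26 (proof)] [cite: BhargavaSkinner2014, Thm 7 (ii) and Lemma 16]
[cite: Kim2022, Thm 1.1] [cite: Skinner2016PacificMC, Thm. C]
[claim: SkinnerZhang2014, status: under-review] [cite: Duke1997, Thm. 1 (p. 815)] -/
theorem HeightDensityGE.rankLeOne_and_fullBSDOffSmPrime_of_resPieces
    (hGZK : rank_eq_analyticRank_of_analyticRank_le_one)
    (hDD : even_selmerRank_sub_torsionRank_iff) (S₀ T U R U₀ P S₁ W : ℤ × ℤ → Prop)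
    (Z : (AB : ℤ × ℤ) → AddSubgroup ((shortWeierstrass AB).selmerGroup 5))
    (hTS₀ : ∀ AB, T AB → S₀ AB) (hUT : ∀ AB, U AB → T AB)
    (hRS₀ : ∀ AB, R AB → S₀ AB) (hRT : ∀ AB, R AB → ¬ T AB) (hU₀R : ∀ AB, U₀ AB → R AB)
    (hPS₀ : ∀ AB, P AB → S₀ AB) (hPT : ∀ AB, P AB → ¬ T AB) (hPR : ∀ AB, P AB → ¬ R AB)
    (hU : ∀ AB, U AB → U (negB AB))
    (hUflip : ∀ AB, U AB →
      (shortWeierstrass (negB AB)).rootNumber = -(shortWeierstrass AB).rootNumber)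
    (hU₀ : ∀ AB, U₀ AB → U₀ (negB AB))
    (hU₀flip : ∀ AB, U₀ AB →
      (shortWeierstrass (negB AB)).rootNumber = -(shortWeierstrass AB).rootNumber)
    (h5 : ∀ AB, IsInHeightFamily AB → S₀ AB → W AB →
      Nat.card ((shortWeierstrass AB).selmerGroup 5) = 1 →
        (shortWeierstrass AB).mordellWeilRank = 0 ∧ (shortWeierstrass AB).analyticRank = 0)
    (h9 : ∀ AB, IsInHeightFamily AB → T AB → S₁ AB → W AB →
      Nat.card ((shortWeierstrass AB).selmerGroup 5) = 5 →
        (shortWeierstrass AB).mordellWeilRank = 1 ∧ (shortWeierstrass AB).analyticRank = 1)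
    (hker : ∀ AB, IsInHeightFamily AB → P AB →
      Nat.card ((shortWeierstrass AB).selmerGroup 5) ≤ 5 * Nat.card (Z AB))
    (hKim : ∀ AB, IsInHeightFamily AB → P AB → W AB →
      Nat.card ((shortWeierstrass AB).selmerGroup 5) = 5 → Nat.card (Z AB) = 1 →
        (shortWeierstrass AB).mordellWeilRank = 1 ∧ (shortWeierstrass AB).analyticRank = 1)
    (hWtors : ∀ AB, IsInHeightFamily AB → W AB → (shortWeierstrass AB).toAffine.Point[(5 : ℤ)] = ⊥)
    (h13T : ∀ η : ℝ, 0 < η → ∀ᶠ X : ℕ in atTop,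
      ∑ AB ∈ (heightFamilyBelow X).filter T,
          (Nat.card ((shortWeierstrass AB).selmerGroup 5) : ℝ) ≤
        (6 + η) * ((heightFamilyBelow X).filter T).card)
    (h13U₀ : ∀ η : ℝ, 0 < η → ∀ᶠ X : ℕ in atTop,
      ∑ AB ∈ (heightFamilyBelow X).filter U₀,
          (Nat.card ((shortWeierstrass AB).selmerGroup 5) : ℝ) ≤
        (6 + η) * ((heightFamilyBelow X).filter U₀).card)
    (hlocP : ∀ η : ℝ, 0 < η → ∀ᶠ X : ℕ in atTop,
      ∑ AB ∈ (heightFamilyBelow X).filter P, ((Nat.card (Z AB) : ℝ) - 1) ≤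
        (1 + η) * ((heightFamilyBelow X).filter P).card)
    {μT κ μR μP ν : ℝ} (hκ : 0 < κ) (hκ1 : κ ≤ 1) (hμT1 : μT ≤ 1) (hμR1 : μR ≤ 1) (hμP1 : μP ≤ 1)
    (hT : ∀ η : ℝ, 0 < η → ∀ᶠ X : ℕ in atTop,
      (μT - η) * (heightFamilyBelow X).card ≤ ((heightFamilyBelow X).filter T).card)
    (hκU : ∀ η : ℝ, 0 < η → ∀ᶠ X : ℕ in atTop,
      (κ - η) * ((heightFamilyBelow X).filter T).card ≤ ((heightFamilyBelow X).filter U).card)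
    (hR : ∀ η : ℝ, 0 < η → ∀ᶠ X : ℕ in atTop,
      (μR - η) * (heightFamilyBelow X).card ≤ ((heightFamilyBelow X).filter R).card)
    (hκU₀ : ∀ η : ℝ, 0 < η → ∀ᶠ X : ℕ in atTop,
      (κ - η) * ((heightFamilyBelow X).filter R).card ≤ ((heightFamilyBelow X).filter U₀).card)
    (hPd : ∀ η : ℝ, 0 < η → ∀ᶠ X : ℕ in atTop,
      (μP - η) * (heightFamilyBelow X).card ≤ ((heightFamilyBelow X).filter P).card)
    (hν : ∀ η : ℝ, 0 < η → ∀ᶠ X : ℕ in atTop,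
      (((heightFamilyBelow X).filter (fun AB ↦ T AB ∧ ¬ S₁ AB)).card : ℝ) ≤
        (ν + η) * (heightFamilyBelow X).card)
    (hW : ∀ η : ℝ, 0 < η → ∀ᶠ X : ℕ in atTop,
      (((heightFamilyBelow X).filter (fun AB ↦ ¬ W AB)).card : ℝ) ≤ η * (heightFamilyBelow X).card)
    (hD : Duke1997_exceptionalPrimes_densityZero)
    (hS30 : padicValRat_bsd_rank_zero) (hZh : WZhang2014_padicValRat_bsd_rank_one_ordinary)
    (hSk : Skinner2016_padicValRat_bsd_rank_zero)
    (hSZ : SkinnerZhang2014.thm1_2_padicVal_bsd_rankOne_OPEN)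
    (hmod : hasEntireLFunction_rat)
    {δ : ℝ} (hδ : δ ≤ (19 / 24 + κ / 12) * μT + 3 / 8 * κ * μR + 3 / 4 * μP - ν) :
    HeightDensityGE
      (fun AB ↦ SatisfiesBSDRankLeOne AB ∧ FullBSDOffSgoPrime AB ∧ FullBSDOffSmPrime AB) δ :=
  HeightDensityGE.rankLeOne_and_fullBSDOffSmPrime_of_sieve hD hS30 hZh hSk hSZ hmod hGZK
    (heightDensityGE_satisfiesBSDRankLeOne_of_resPieces hGZK hDD S₀ T U R U₀ P S₁ W Z hTS₀ hUT hRS₀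
      hRT hU₀R hPS₀ hPT hPR hU hUflip hU₀ hU₀flip h5 h9 hker hKim hWtors h13T h13U₀ hlocP hκ hκ1 hμT1
      hμR1 hμP1 hT hκU hR hκU₀ hPd hν hW hδ)

/-- **Row (ii-2) of `PERCENT-FULL.md` AT THE CELL'S CONSTANT `c_rank = 3059480216411717 /
4576171406400000 = 0.66856766…`, from the pieces** — the statement of
`heightDensityGE_rankLeOne_and_fullBSDOffSmPrime_cRank_of_sieve` with its bare hypothesis `hA`
REPLACED by the primary inputs (`bsz_rankLeOne_cRank_of_pieces`); Skinner–Zhang 2014 Thm. 1.2 stays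
the OPEN binder `hSZ`; everything else a published theorem vendored as a named fact, a kernel theorem,
or an explicit hypothesis of the counting.
[cite: BhargavaSkinnerZhang2014, Cor. 26 (proof) with Lemma 18 corrected]
[cite: BhargavaSkinner2014, Thm 7 (ii) and Lemma 16] [cite: Kim2022, Thm 1.1]
[cite: Skinner2016PacificMC, Thm. C] [claim: SkinnerZhang2014, status: under-review] -/
theorem heightDensityGE_rankLeOne_and_fullBSDOffSmPrime_cRank_of_pieces
    (hGZK : rank_eq_analyticRank_of_analyticRank_le_one)
    (hDD : even_selmerRank_sub_torsionRank_iff) (S₀ T U R U₀ P S₁ W : ℤ × ℤ → Prop)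
    (Z : (AB : ℤ × ℤ) → AddSubgroup ((shortWeierstrass AB).selmerGroup 5))
    (hTS₀ : ∀ AB, T AB → S₀ AB) (hUT : ∀ AB, U AB → T AB)
    (hRS₀ : ∀ AB, R AB → S₀ AB) (hRT : ∀ AB, R AB → ¬ T AB) (hU₀R : ∀ AB, U₀ AB → R AB)
    (hPS₀ : ∀ AB, P AB → S₀ AB) (hPT : ∀ AB, P AB → ¬ T AB) (hPR : ∀ AB, P AB → ¬ R AB)
    (hU : ∀ AB, U AB → U (negB AB))
    (hUflip : ∀ AB, U AB →
      (shortWeierstrass (negB AB)).rootNumber = -(shortWeierstrass AB).rootNumber)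
    (hU₀ : ∀ AB, U₀ AB → U₀ (negB AB))
    (hU₀flip : ∀ AB, U₀ AB →
      (shortWeierstrass (negB AB)).rootNumber = -(shortWeierstrass AB).rootNumber)
    (h5 : ∀ AB, IsInHeightFamily AB → S₀ AB → W AB →
      Nat.card ((shortWeierstrass AB).selmerGroup 5) = 1 →
        (shortWeierstrass AB).mordellWeilRank = 0 ∧ (shortWeierstrass AB).analyticRank = 0)
    (h9 : ∀ AB, IsInHeightFamily AB → T AB → S₁ AB → W AB →
      Nat.card ((shortWeierstrass AB).selmerGroup 5) = 5 →
        (shortWeierstrass AB).mordellWeilRank = 1 ∧ (shortWeierstrass AB).analyticRank = 1)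
    (hker : ∀ AB, IsInHeightFamily AB → P AB →
      Nat.card ((shortWeierstrass AB).selmerGroup 5) ≤ 5 * Nat.card (Z AB))
    (hKim : ∀ AB, IsInHeightFamily AB → P AB → W AB →
      Nat.card ((shortWeierstrass AB).selmerGroup 5) = 5 → Nat.card (Z AB) = 1 →
        (shortWeierstrass AB).mordellWeilRank = 1 ∧ (shortWeierstrass AB).analyticRank = 1)
    (hWtors : ∀ AB, IsInHeightFamily AB → W AB → (shortWeierstrass AB).toAffine.Point[(5 : ℤ)] = ⊥)
    (h13T : ∀ η : ℝ, 0 < η → ∀ᶠ X : ℕ in atTop,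
      ∑ AB ∈ (heightFamilyBelow X).filter T,
          (Nat.card ((shortWeierstrass AB).selmerGroup 5) : ℝ) ≤
        (6 + η) * ((heightFamilyBelow X).filter T).card)
    (h13U₀ : ∀ η : ℝ, 0 < η → ∀ᶠ X : ℕ in atTop,
      ∑ AB ∈ (heightFamilyBelow X).filter U₀,
          (Nat.card ((shortWeierstrass AB).selmerGroup 5) : ℝ) ≤
        (6 + η) * ((heightFamilyBelow X).filter U₀).card)
    (hlocP : ∀ η : ℝ, 0 < η → ∀ᶠ X : ℕ in atTop,
      ∑ AB ∈ (heightFamilyBelow X).filter P, ((Nat.card (Z AB) : ℝ) - 1) ≤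
        (1 + η) * ((heightFamilyBelow X).filter P).card)
    (hT : ∀ η : ℝ, 0 < η → ∀ᶠ X : ℕ in atTop,
      (747265625 / 953369043 - η) * (heightFamilyBelow X).card ≤
        ((heightFamilyBelow X).filter T).card)
    (hκU : ∀ η : ℝ, 0 < η → ∀ᶠ X : ℕ in atTop,
      (0.5501 - η) * ((heightFamilyBelow X).filter T).card ≤ ((heightFamilyBelow X).filter U).card)
    (hR : ∀ η : ℝ, 0 < η → ∀ᶠ X : ℕ in atTop,
      (78125 / 3813476172 - η) * (heightFamilyBelow X).card ≤ ((heightFamilyBelow X).filter R).card)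
    (hκU₀ : ∀ η : ℝ, 0 < η → ∀ᶠ X : ℕ in atTop,
      (0.5501 - η) * ((heightFamilyBelow X).filter R).card ≤ ((heightFamilyBelow X).filter U₀).card)
    (hPd : ∀ η : ℝ, 0 < η → ∀ᶠ X : ℕ in atTop,
      (20546875 / 1271158724 - 1 / 1000000 - η) * (heightFamilyBelow X).card ≤
        ((heightFamilyBelow X).filter P).card)
    (hν : ∀ η : ℝ, 0 < η → ∀ᶠ X : ℕ in atTop,
      (((heightFamilyBelow X).filter (fun AB ↦ T AB ∧ ¬ S₁ AB)).card : ℝ) ≤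
        (0.00001 + η) * (heightFamilyBelow X).card)
    (hW : ∀ η : ℝ, 0 < η → ∀ᶠ X : ℕ in atTop,
      (((heightFamilyBelow X).filter (fun AB ↦ ¬ W AB)).card : ℝ) ≤ η * (heightFamilyBelow X).card)
    (hD : Duke1997_exceptionalPrimes_densityZero)
    (hS30 : padicValRat_bsd_rank_zero) (hZh : WZhang2014_padicValRat_bsd_rank_one_ordinary)
    (hSk : Skinner2016_padicValRat_bsd_rank_zero)
    (hSZ : SkinnerZhang2014.thm1_2_padicVal_bsd_rankOne_OPEN)
    (hmod : hasEntireLFunction_rat) :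
    HeightDensityGE
      (fun AB ↦ SatisfiesBSDRankLeOne AB ∧ FullBSDOffSgoPrime AB ∧ FullBSDOffSmPrime AB)
      (3059480216411717 / 4576171406400000) :=
  heightDensityGE_rankLeOne_and_fullBSDOffSmPrime_cRank_of_sieve
    (bsz_rankLeOne_cRank_of_pieces hGZK hDD S₀ T U R U₀ P S₁ W Z hTS₀ hUT hRS₀ hRT hU₀R hPS₀ hPT hPR
      hU hUflip hU₀ hU₀flip h5 h9 hker hKim hWtors h13T h13U₀ hlocP hT hκU hR hκU₀ hPd hν hW)
    hD hS30 hZh hSk hSZ hmod hGZK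

end Literature.NumberTheory.EllipticCurves

end
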